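import Mathlib

/-!
# The alteration (deletion) lemma for strong representative systems
(crux `LevelOneGL2Designs`, stmt-MatrixMultiplication-14080, stub `stub_tangencySets`; wall-breaker
axis 3/12: random-algebraic constructions with certified small instances)

The basic tool of every random or random-algebraic construction of a strong representative
system: start from ANY finite family `F` of incident point–line pairs `(a, b)` (`a ⬝ᵥ b = 1`) — an
algebraic family, a random sample, an orbit union — and delete the first member of every
*conflicting* ordered pair (`f ≠ f'` with `f.1 ⬝ᵥ f'.2 = 1`).  What remains is a strong
representative system in the normal form of the stub, of size at least `#F − #conflicts`
(`srs_alteration`).  In particular a family with fewer conflicting pairs than members contains a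
non-trivial system, and a family with `o(#F)` conflicts contains one of size `(1 − o(1)) #F`
(`srs_alteration_half` records the 50 % form used with Markov's inequality).
Elementary; valid over `ZMod p` for every `p`.
-/

set_option linter.dupNamespace false -- `MatrixMultiplication.MatrixMultiplication` (summit = problem, D-0017)

open Finset

namespace Summit.MatrixMultiplication.MatrixMultiplication.Theorems.LevelOneGL2Designs.FlagLine

section Alteration

variable {p : ℕ}

/-- **Alteration lemma.**  From any finite family `F` of incident flags (`a ⬝ᵥ b = 1`) one obtains,
by deleting the first member of every conflicting ordered pair, a sub-family `S ⊆ F` which is a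
strong representative system in normal form (`f.1 ⬝ᵥ f'.2 = 1 ↔ f = f'`) and satisfies
`#F ≤ #S + #{conflicting ordered pairs}`. [elementary; the deletion method] -/
theorem srs_alteration (F : Finset ((Fin 2 → ZMod p) × (Fin 2 → ZMod p)))
    (hF : ∀ f ∈ F, f.1 ⬝ᵥ f.2 = 1) :
    ∃ S ⊆ F, #F ≤ #S + #((F ×ˢ F).filter fun q => q.1 ≠ q.2 ∧ q.1.1 ⬝ᵥ q.2.2 = 1) ∧
      ∀ f ∈ S, ∀ f' ∈ S, (f.1 ⬝ᵥ f'.2 = 1 ↔ f = f') := by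
  classical
  set C := (F ×ˢ F).filter fun q => q.1 ≠ q.2 ∧ q.1.1 ⬝ᵥ q.2.2 = 1 with hC
  set B := C.image Prod.fst with hB
  refine ⟨F \ B, sdiff_subset, ?_, ?_⟩
  · have h1 : #F - #B ≤ #(F \ B) := le_card_sdiff B F
    have h2 : #B ≤ #C := card_image_le
    omega
  · intro f hf f' hf'
    rw [mem_sdiff] at hf hf'
    constructor
    · intro h1
      by_contra hne
      apply hf.2
      rw [hB, mem_image]
      refine ⟨(f, f'), ?_, rfl⟩
      rw [hC, mem_filter, mem_product]
      exact ⟨⟨hf.1, hf'.1⟩, hne, h1⟩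
    · rintro rfl
      exact hF f hf.1

/-- **Alteration, 50 % form.**  If the conflicting ordered pairs of an incident family `F` number
at most half of `#F`, then `F` contains a normal-form strong representative system with
`2 · #S ≥ #F`. [elementary] -/
theorem srs_alteration_half (F : Finset ((Fin 2 → ZMod p) × (Fin 2 → ZMod p)))
    (hF : ∀ f ∈ F, f.1 ⬝ᵥ f.2 = 1)
    (hconf : 2 * #((F ×ˢ F).filter fun q => q.1 ≠ q.2 ∧ q.1.1 ⬝ᵥ q.2.2 = 1) ≤ #F) :
    ∃ S ⊆ F, #F ≤ 2 * #S ∧ ∀ f ∈ S, ∀ f' ∈ S, (f.1 ⬝ᵥ f'.2 = 1 ↔ f = f') := by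
  obtain ⟨S, hS, hcard, hsrs⟩ := srs_alteration F hF
  exact ⟨S, hS, by omega, hsrs⟩

end Alteration

end Summit.MatrixMultiplication.MatrixMultiplication.Theorems.LevelOneGL2Designs.FlagLine
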